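import Summits.AtomisticToContinuum.BoseEinsteinCondensation.Theorems.BECHusimiAmplitudeGasPeriodicBECNonnegGroundState
import Summits.AtomisticToContinuum.BoseEinsteinCondensation.Theorems.BECInfDivCoherenceLevyMassCondensationTranslation
import Literature.MathematicalPhysics.QuantumManyBody.PeriodicCoherenceFunction
import HarnessLib

/-!
# Crux `LevyNegativeMoment` (stmt-AtomisticToContinuum-9115) — positivity of the translation coherence of
# near-minimisers for BOUNDED admissible pair potentials (route `BECInfDivCoherence`, line `registered`,
# lead cycle 3; supports, does not close, the crux)

The target-strength certificate of this crux (`…LevyNegativeMomentTargetStrength.lean`, lead c2: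
`periodicBEC_of_levyNegativeMoment_of_coherencePos`) derives the route target (body of
`BECPeriodicReduction.PeriodicBEC`) from the crux under ONE side hypothesis, `CoherencePos`: near-minimisers
of the periodic `N`-body energy have strictly positive translation coherence
`G_Ψ(i,r) = Re ∫_{cell^N} conj Ψ(…, xᵢ + r, …) Ψ(X) dX` (the first conjunct of the sister crux
`GridInfDivCoherence`, stmt-9114). This file DISCHARGES that hypothesis at fixed `(N, L)` for every BOUNDED
admissible potential (`v` measurable, finite range, `v ≤ M < ∞`: square wells, steps, shells, truncated hard
cores), with `δ = δ(v, N, L)` chosen after `N` exactly as in the crux: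

* `CoherencePos.coherencePos_of_bounded` — **for bounded admissible `v`, `L > 0` and every `N` there is
  `δ > 0` such that every periodic `C¹` Bose trial state `Φ` with `periodicEnergy v Φ ≤ E₀^per + δ` has
  `G_Φ(i,r) > 0` for all `i` and all `r ∈ ℝ³`.**

Ingredients, all from the tree: the pointwise positive `C¹` minimiser `Ψ₀` of the bounded class
(`boundedPositiveMinimiser_holds`, route BECConjugateDomination: Perron–Frobenius via Feynman–Kac plus
`C¹`-regularity); the spectral gap of the bosonic torus ground state for bounded periodisations
(`PeriodicGroundStateNondegenerate_holds`, Reed–Simon IV §XIII.12) through the min–max dictionary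
(`TwoModeData` of `formEmbed`) and phase alignment, giving `∫_cell |Ψ₀ - cΦ|² ≤ η²` for near-minimisers
(`exists_phase_near_of_nearMinimiser`, the first half of `nearMinimiserStability_of_bounded` verbatim);
and two elementary facts proved here: the coherence is `2`-Lipschitz in `L²(cell)` and phase-blind
(`abs_coh_sub_coh_le`: Cauchy–Schwarz on the cell + shift invariance of cell integrals of periodic
functions), and the coherence of a positive state has a uniform floor `g > 0` over `(i, r)`
(`exists_pos_le_coh`: positivity, dominated-convergence continuity, `Lℤ³`-periodicity, compactness of
`[0,L]³`). With `η = g/4`: `G_Φ ≥ G_{Ψ₀} - 2η ≥ g/2 > 0`.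

What is NOT here: hard cores / unbounded `v` (no `C¹` minimiser, and for `⊤`-valued potentials the
nondegeneracy of the periodic ground state is not in the tree — cf. cruxes `HardCoreExtension`,
`GroundStateRigidity`). The sequel `…TargetStrengthBounded.lean` combines this file with the certificate:
on the bounded sector the crux ALONE gives the `PeriodicBEC` clause.

References: M. Reed, B. Simon, *Methods of Modern Mathematical Physics IV* (1978), Thm XIII.1, §XIII.12
Thms XIII.43–XIII.47 [ReedSimonIV1978]; E. H. Lieb, R. Seiringer, J. P. Solovej, J. Yngvason, *The
Mathematics of the Bose Gas and its Condensation* (2005), §1.2 [LSSY2005].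
-/

noncomputable section

namespace Summit.AtomisticToContinuum.BoseEinsteinCondensation.Theorems

open MeasureTheory Filter Set Complex
open scoped ENNReal NNReal Topology ComplexConjugate InnerProductSpace
open Literature.MathematicalPhysics.QuantumManyBody
open Literature.MathematicalPhysics.QuantumManyBody.BoseGas Literature.Analysis.InnerProduct
open Summit.AtomisticToContinuum.BoseEinsteinCondensation.Cruxes.HardCoreExtension.ThirdLawCurrentFloor
  (boundedPositiveMinimiser_holds)
open InfDivGlue

namespace CoherencePos

variable {N : ℕ} {L : ℝ}

/-! ### Cauchy–Schwarz on the cell -/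

/-- Cauchy–Schwarz in `ℝ≥0∞`: `∫⁻ f g ≤ a b` when `∫⁻ f² ≤ a²` and `∫⁻ g² ≤ b²`. [folklore] -/
theorem lintegral_mul_le_of_sq_le {α : Type*} [MeasurableSpace α] (μ : Measure α) {f g : α → ℝ≥0∞}
    (hf : AEMeasurable f μ) (hg : AEMeasurable g μ) {a b : ℝ≥0∞}
    (ha : ∫⁻ x, f x ^ 2 ∂μ ≤ a ^ 2) (hb : ∫⁻ x, g x ^ 2 ∂μ ≤ b ^ 2) :
    ∫⁻ x, f x * g x ∂μ ≤ a * b := by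
  have hH := ENNReal.lintegral_mul_le_Lp_mul_Lq μ Real.HolderConjugate.two_two hf hg
  have h2 : ∀ y : ℝ≥0∞, y ^ (2 : ℝ) = y ^ 2 := fun y => ENNReal.rpow_two y
  have hroot : ∀ y : ℝ≥0∞, (y ^ 2) ^ (1 / (2 : ℝ)) = y := fun y => by
    rw [one_div, ← ENNReal.rpow_two, ← ENNReal.rpow_mul]; norm_num
  simp only [Pi.mul_apply, h2] at hH
  refine hH.trans (mul_le_mul' ?_ ?_)
  · calc (∫⁻ x, f x ^ 2 ∂μ) ^ (1 / (2 : ℝ)) ≤ (a ^ 2) ^ (1 / (2 : ℝ)) :=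
          ENNReal.rpow_le_rpow ha (by norm_num)
      _ = a := hroot a
  · calc (∫⁻ x, g x ^ 2 ∂μ) ^ (1 / (2 : ℝ)) ≤ (b ^ 2) ^ (1 / (2 : ℝ)) :=
          ENNReal.rpow_le_rpow hb (by norm_num)
      _ = b := hroot b

/-! ### Lipschitz continuity of the coherence in `L²` of the cell -/

/-- **The translation coherence is `2`-Lipschitz in `L²(cell)` up to a phase.** For periodic trial
states `Ψ, Φ`, a unit complex number `c` and `η > 0` with `∫_{cell^N} |Ψ - cΦ|² ≤ η²`, the
coherences `G_Ψ(i,r) = Re ∫ conj Ψ(X + eᵢ⊗r) Ψ(X)` and `G_Φ(i,r)` differ by at most `2η` (write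
`conj Ψ(TX)Ψ(X) - conj(cΦ(TX))(cΦ(X)) = conj(Ψ - cΦ)(TX)·Ψ(X) + conj(cΦ(TX))·(Ψ - cΦ)(X)`, Cauchy–Schwarz
on the cell and shift invariance of the cell integral of periodic functions). [folklore] -/
theorem abs_coh_sub_coh_le (hL : 0 < L) (Ψ Φ : PeriodicTrialState N L) {c : ℂ} (hc : ‖c‖ = 1)
    (i : Fin N) (r : Space) {η : ℝ} (hη : 0 ≤ η)
    (hclose : ∫⁻ X in cellN N L, (‖Ψ.ψ X - c * Φ.ψ X‖₊ : ℝ≥0∞) ^ 2 ≤ ENNReal.ofReal (η ^ 2)) :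
    |(∫ X in cellN N L, conj (Ψ.ψ (Function.update X i (X i + r))) * Ψ.ψ X).re -
      (∫ X in cellN N L, conj (Φ.ψ (Function.update X i (X i + r))) * Φ.ψ X).re| ≤ 2 * η := by
  simp_rw [update_eq_add_single]
  set T : Config N := Pi.single i r with hT
  have hΨc := Ψ.contDiff.continuous
  have hΦc := Φ.contDiff.continuous
  have hΨT : Continuous fun X : Config N => Ψ.ψ (X + T) := hΨc.comp (continuous_id.add continuous_const)
  have hΦT : Continuous fun X : Config N => Φ.ψ (X + T) := hΦc.comp (continuous_id.add continuous_const)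
  -- the two integrands
  set f : Config N → ℂ := fun X => conj (Ψ.ψ (X + T)) * Ψ.ψ X with hf
  set g : Config N → ℂ := fun X => conj (Φ.ψ (X + T)) * Φ.ψ X with hg
  have hfc : Continuous f := (Complex.continuous_conj.comp hΨT).mul hΨc
  have hgc : Continuous g := (Complex.continuous_conj.comp hΦT).mul hΦc
  have hfi : Integrable f (volume.restrict (cellN N L)) := integrableOn_cellN hfc L
  have hgi : Integrable g (volume.restrict (cellN N L)) := integrableOn_cellN hgc L
  -- `c Φ` has the same coherence integrand as `Φ`
  have hcc : conj c * c = 1 := by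
    rw [Complex.conj_mul', hc]; norm_num
  -- pointwise decomposition of `f - g`
  have hdec : ∀ X, f X - g X =
      conj (Ψ.ψ (X + T) - c * Φ.ψ (X + T)) * Ψ.ψ X + conj (c * Φ.ψ (X + T)) * (Ψ.ψ X - c * Φ.ψ X) := by
    intro X
    simp only [hf, hg, map_sub, map_mul]
    linear_combination (Φ.ψ X * conj (Φ.ψ (X + T))) * hcc
  -- pointwise norm bound
  have hpt : ∀ X, (‖f X - g X‖₊ : ℝ≥0∞) ≤
      (‖Ψ.ψ (X + T) - c * Φ.ψ (X + T)‖₊ : ℝ≥0∞) * ‖Ψ.ψ X‖₊ +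
        (‖Φ.ψ (X + T)‖₊ : ℝ≥0∞) * ‖Ψ.ψ X - c * Φ.ψ X‖₊ := by
    intro X
    rw [hdec X]
    have h1 := nnnorm_add_le (conj (Ψ.ψ (X + T) - c * Φ.ψ (X + T)) * Ψ.ψ X)
      (conj (c * Φ.ψ (X + T)) * (Ψ.ψ X - c * Φ.ψ X))
    rw [nnnorm_mul, nnnorm_mul, RCLike.nnnorm_conj, RCLike.nnnorm_conj, nnnorm_mul] at h1
    have hcn : ‖c‖₊ = 1 := by ext; rw [coe_nnnorm, hc]; rfl
    rw [hcn, one_mul] at h1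
    exact_mod_cast h1
  -- the four square integrals
  have hperD : ∀ (X : Config N) (j : Fin N) (k : Fin 3),
      (fun X => (‖Ψ.ψ X - c * Φ.ψ X‖₊ : ℝ≥0∞) ^ 2) (X + Pi.single j (EuclideanSpace.single k L)) =
        (fun X => (‖Ψ.ψ X - c * Φ.ψ X‖₊ : ℝ≥0∞) ^ 2) X := by
    intro X j k; simp only [Ψ.periodic, Φ.periodic]
  have hA : ∫⁻ X in cellN N L, (‖Ψ.ψ (X + T) - c * Φ.ψ (X + T)‖₊ : ℝ≥0∞) ^ 2 ≤ ENNReal.ofReal η ^ 2 := by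
    rw [lintegral_cellN_comp_add hL (G := fun X => (‖Ψ.ψ X - c * Φ.ψ X‖₊ : ℝ≥0∞) ^ 2) hperD T,
      ← ENNReal.ofReal_pow hη]
    exact hclose
  have hB : ∫⁻ X in cellN N L, (‖Ψ.ψ X‖₊ : ℝ≥0∞) ^ 2 ≤ 1 ^ 2 := by rw [one_pow, Ψ.norm_eq]
  have hA' : ∫⁻ X in cellN N L, (‖Φ.ψ (X + T)‖₊ : ℝ≥0∞) ^ 2 ≤ 1 ^ 2 := by
    rw [one_pow, lintegral_norm_sq_translate hL Φ T]
  have hB' : ∫⁻ X in cellN N L, (‖Ψ.ψ X - c * Φ.ψ X‖₊ : ℝ≥0∞) ^ 2 ≤ ENNReal.ofReal η ^ 2 := by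
    rw [← ENNReal.ofReal_pow hη]; exact hclose
  -- measurability
  have hmD : Continuous fun X : Config N => Ψ.ψ X - c * Φ.ψ X := hΨc.sub (continuous_const.mul hΦc)
  have hmDT : Continuous fun X : Config N => Ψ.ψ (X + T) - c * Φ.ψ (X + T) :=
    hΨT.sub (continuous_const.mul hΦT)
  have meas : ∀ {F : Config N → ℂ}, Continuous F →
      AEMeasurable (fun X => (‖F X‖₊ : ℝ≥0∞)) (volume.restrict (cellN N L)) := fun hF =>
    (ENNReal.continuous_coe.comp hF.nnnorm).measurable.aemeasurable
  -- Cauchy–Schwarz twice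
  have hCS1 := lintegral_mul_le_of_sq_le (volume.restrict (cellN N L)) (meas hmDT) (meas hΨc) hA hB
  have hCS2 := lintegral_mul_le_of_sq_le (volume.restrict (cellN N L)) (meas hΦT) (meas hmD) hA' hB'
  have hlin : ∫⁻ X in cellN N L, (‖f X - g X‖₊ : ℝ≥0∞) ≤ ENNReal.ofReal (2 * η) := by
    calc ∫⁻ X in cellN N L, (‖f X - g X‖₊ : ℝ≥0∞)
        ≤ ∫⁻ X in cellN N L, ((‖Ψ.ψ (X + T) - c * Φ.ψ (X + T)‖₊ : ℝ≥0∞) * ‖Ψ.ψ X‖₊ +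
            (‖Φ.ψ (X + T)‖₊ : ℝ≥0∞) * ‖Ψ.ψ X - c * Φ.ψ X‖₊) := lintegral_mono hpt
      _ = (∫⁻ X in cellN N L, (‖Ψ.ψ (X + T) - c * Φ.ψ (X + T)‖₊ : ℝ≥0∞) * ‖Ψ.ψ X‖₊) +
            ∫⁻ X in cellN N L, (‖Φ.ψ (X + T)‖₊ : ℝ≥0∞) * ‖Ψ.ψ X - c * Φ.ψ X‖₊ :=
          lintegral_add_left' ((meas hmDT).mul (meas hΨc)) _
      _ ≤ ENNReal.ofReal η * 1 + 1 * ENNReal.ofReal η := add_le_add hCS1 hCS2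
      _ = ENNReal.ofReal (2 * η) := by
          rw [mul_one, one_mul, ← ENNReal.ofReal_add hη hη, two_mul]
  -- back to the Bochner integrals
  have hsub : (∫ X in cellN N L, f X) - (∫ X in cellN N L, g X) = ∫ X in cellN N L, (f X - g X) :=
    (integral_sub hfi hgi).symm
  rw [← Complex.sub_re, hsub]
  calc |(∫ X in cellN N L, (f X - g X)).re| ≤ ‖∫ X in cellN N L, (f X - g X)‖ := Complex.abs_re_le_norm _
    _ ≤ ∫ X in cellN N L, ‖f X - g X‖ := norm_integral_le_integral_norm _
    _ = (∫⁻ X in cellN N L, ‖f X - g X‖ₑ).toReal :=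
        integral_norm_eq_lintegral_enorm (hfi.sub hgi).aestronglyMeasurable
    _ ≤ 2 * η := by
        have h1 : (∫⁻ X in cellN N L, ‖f X - g X‖ₑ) ≤ ENNReal.ofReal (2 * η) := by
          simpa only [enorm_eq_nnnorm] using hlin
        have h2 := ENNReal.toReal_mono ENNReal.ofReal_ne_top h1
        rwa [ENNReal.toReal_ofReal (by positivity)] at h2


/-! ### The coherence of a positive state: positivity, continuity, a uniform floor -/

/-- **Positivity of the coherence of a positive state**: if `Ψ` is pointwise a non-zero
non-negative real, `G_Ψ(i,r) = ∫_{cell^N} |Ψ(X + eᵢ⊗r)| |Ψ(X)| dX > 0` for every particle `i` and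
every `r` (a continuous positive integrand on a cell of positive measure). [folklore] -/
theorem coh_pos_of_pos (hL : 0 < L) (Ψ : PeriodicTrialState N L)
    (hreal : ∀ X, Ψ.ψ X = (‖Ψ.ψ X‖ : ℂ)) (hne : ∀ X, Ψ.ψ X ≠ 0) (i : Fin N) (r : Space) :
    0 < (∫ X in cellN N L, conj (Ψ.ψ (Function.update X i (X i + r))) * Ψ.ψ X).re := by
  simp_rw [update_eq_add_single]
  set T : Config N := Pi.single i r with hT
  have hc := Ψ.contDiff.continuous
  have hint : ∀ X, conj (Ψ.ψ (X + T)) * Ψ.ψ X = ((‖Ψ.ψ (X + T)‖ * ‖Ψ.ψ X‖ : ℝ) : ℂ) := by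
    intro X
    rw [Complex.ofReal_mul]
    conv_lhs => rw [hreal (X + T), hreal X]
    rw [Complex.conj_ofReal]
  simp_rw [hint]
  rw [integral_complex_ofReal, Complex.ofReal_re]
  have hcont : Continuous fun X : Config N => ‖Ψ.ψ (X + T)‖ * ‖Ψ.ψ X‖ := by fun_prop
  rw [integral_pos_iff_support_of_nonneg (fun X => by positivity) (integrableOn_cellN hcont L)]
  have hsupp : Function.support (fun X : Config N => ‖Ψ.ψ (X + T)‖ * ‖Ψ.ψ X‖) = Set.univ := by
    ext X
    simp only [Function.mem_support, ne_eq, mul_eq_zero, norm_eq_zero, Set.mem_univ, iff_true]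
    push Not
    exact ⟨hne _, hne _⟩
  rw [hsupp, Measure.restrict_apply_univ]
  exact cellN_volume_pos hL N

/-- **Continuity of the coherence** `r ↦ G_Ψ(i,r)` (dominated convergence: `Ψ` is bounded and the
cell has finite measure). [folklore] -/
theorem continuous_coh (hL : 0 < L) (Ψ : PeriodicTrialState N L) (i : Fin N) :
    Continuous fun r : Space =>
      (∫ X in cellN N L, conj (Ψ.ψ (Function.update X i (X i + r))) * Ψ.ψ X).re := by
  obtain ⟨M, hM⟩ := Ψ.exists_norm_le hL
  have hM0 : 0 ≤ M := (norm_nonneg _).trans (hM 0)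
  have hc := Ψ.contDiff.continuous
  refine Complex.continuous_re.comp ?_
  refine continuous_of_dominated (bound := fun _ => M * M) ?_ ?_ ?_ ?_
  · intro r
    refine (Continuous.mul (Complex.continuous_conj.comp (hc.comp ?_)) hc).aestronglyMeasurable
    exact continuous_id.update i ((continuous_apply i).add continuous_const)
  · intro r
    refine Eventually.of_forall fun X => ?_
    rw [norm_mul, Complex.norm_conj]
    exact mul_le_mul (hM _) (hM _) (norm_nonneg _) hM0
  · exact integrableOn_const (cellN_volume_lt_top N L).ne
  · refine Eventually.of_forall fun X => ?_
    refine (Complex.continuous_conj.comp (hc.comp ?_)).mul continuous_const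
    exact continuous_const.update i (continuous_const.add continuous_id)

/-- A continuous, `Lℤ³`-periodic, pointwise positive function on `ℝ³` is bounded below by a
positive constant (it attains its minimum on the compact closed box `[0,L]³`, which meets every
class modulo the lattice). [folklore] -/
theorem exists_pos_le_of_periodic (hL : 0 < L) {f : Space → ℝ} (hf : Continuous f)
    (hper : ∀ (x : Space) (k : Fin 3), f (x + EuclideanSpace.single k L) = f x)
    (hpos : ∀ x, 0 < f x) : ∃ g : ℝ, 0 < g ∧ ∀ x, g ≤ f x := by
  obtain ⟨x₀, _, hmin⟩ := (isCompact_closedBox L).exists_isMinOn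
    ⟨_, fromUnitTorus_mem_closedBox hL 0⟩ hf.continuousOn
  refine ⟨f x₀, hpos x₀, fun x => ?_⟩
  obtain ⟨m, hm⟩ := exists_fromUnitTorus_toUnitTorus_eq hL x
  have hx : f x = f (fromUnitTorus L (toUnitTorus L x)) := by rw [hm, periodic_latticeVec hper]
  rw [hx]
  exact isMinOn_iff.1 hmin _ (fromUnitTorus_mem_closedBox hL _)

/-- **A uniform floor under the coherence of a positive state**: for `Ψ` pointwise a non-zero
non-negative real there is `g > 0` with `G_Ψ(i,r) ≥ g` for all particles `i` and all `r ∈ ℝ³`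
(positivity, continuity and `Lℤ³`-periodicity in `r`; finitely many `i`). [folklore] -/
theorem exists_pos_le_coh (hL : 0 < L) (Ψ : PeriodicTrialState N L)
    (hreal : ∀ X, Ψ.ψ X = (‖Ψ.ψ X‖ : ℂ)) (hne : ∀ X, Ψ.ψ X ≠ 0) :
    ∃ g : ℝ, 0 < g ∧ ∀ (i : Fin N) (r : Space),
      g ≤ (∫ X in cellN N L, conj (Ψ.ψ (Function.update X i (X i + r))) * Ψ.ψ X).re := by
  have key : ∀ i : Fin N, ∃ g : ℝ, 0 < g ∧ ∀ r : Space,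
      g ≤ (∫ X in cellN N L, conj (Ψ.ψ (Function.update X i (X i + r))) * Ψ.ψ X).re := fun i =>
    exists_pos_le_of_periodic hL (continuous_coh hL Ψ i) (fun r k => coh_add_single Ψ i r k)
      (coh_pos_of_pos hL Ψ hreal hne i)
  choose g hg hle using key
  rcases isEmpty_or_nonempty (Fin N) with hN | hN
  · exact ⟨1, one_pos, fun i => (hN.false i).elim⟩
  · obtain ⟨i₀, -, hi₀⟩ := Finset.exists_min_image Finset.univ g Finset.univ_nonempty
    exact ⟨g i₀, hg i₀, fun i r => (hi₀ i (Finset.mem_univ i)).trans (hle i r)⟩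

/-! ### Near-minimisers are `L²`-close to the minimiser (bounded admissible class) -/

/-- **Near-minimisers are `L²(cell)`-close to a minimiser, up to a phase** (bounded admissible pair
potentials). For `v ≤ M < ∞` admissible, `N = n + 1`, `L > 0` and `η > 0` there is `δ > 0` such that
for every minimiser `Ψ` and every `δ`-near-minimiser `Φ` of the periodic `N`-body energy,
`∫_{cell^N} |Ψ - cΦ|² ≤ η²` for some unit complex `c`: the min–max dictionary of the tree
(`TwoModeData` of `formEmbed`, `E₀ = κ₁⁻¹ - 1`, `kyFanTwo = κ₁⁻¹ + κ₂⁻¹ - 2`), the gap from the proved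
nondegeneracy of the bosonic torus ground state for bounded periodisations
(`PeriodicGroundStateNondegenerate_holds`), and phase alignment
(`twoModeData_exists_phase_norm_sub_sq_le`) with `δ = (κ₂⁻¹ - κ₁⁻¹)η²/2` — verbatim the first half
of `nearMinimiserStability_of_bounded`. [cite: ReedSimonIV1978, Thm. XIII.1 and §XIII.12 Thms XIII.43–XIII.46] -/
theorem exists_phase_near_of_nearMinimiser {v : ℝ → ℝ≥0∞} (hv : IsRepulsiveFiniteRange v)
    {M : ℝ≥0} (hM : ∀ r, v r ≤ M) (n : ℕ) {L : ℝ} (hL : 0 < L) {η : ℝ} (hη : 0 < η) :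
    ∃ δ : ℝ≥0∞, 0 < δ ∧ ∀ Ψ Φ : PeriodicTrialState (n + 1) L,
      periodicEnergy v Ψ = periodicGroundStateEnergy v (n + 1) L →
      periodicEnergy v Φ ≤ periodicGroundStateEnergy v (n + 1) L + δ →
      ∃ c : ℂ, ‖c‖ = 1 ∧
        ∫⁻ X in cellN (n + 1) L, (‖Ψ.ψ X - c * Φ.ψ X‖₊ : ℝ≥0∞) ^ 2 ≤ ENNReal.ofReal (η ^ 2) := by
  obtain ⟨hmeas, R₀, hR₀⟩ := hv
  -- bounded periodisation, `W ∈ L¹(cell)`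
  obtain ⟨C, hC⟩ := exists_bound_periodizedPotential hL hM hR₀
  have hW : ∫⁻ X in cellN (n + 1) L, periodicInteraction v L X ≠ ⊤ :=
    lintegral_periodicInteraction_ne_top hC (n + 1)
  -- the graph map into the form domain `Q` and the embedding `ι : Q → H = L²`
  set J := (graphEmbed hL hmeas hW).codRestrict (formDomain hL hmeas hW)
    (graphEmbed_mem_formDomain hL hmeas hW) with hJ
  have hJapply : ∀ F : periodicCore (n + 1) L,
      J F = ⟨graphEmbed hL hmeas hW F, graphEmbed_mem_formDomain hL hmeas hW F⟩ := fun F => rfl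
  set ι := formEmbed hL hmeas hW with hι
  -- spectral data of the two lowest eigenvalues, and the gap
  obtain ⟨d⟩ := nonempty_twoModeData hL hmeas hW (Nat.succ_pos n)
  have hE₀ : periodicGroundStateEnergy v (n + 1) L = ENNReal.ofReal (d.κ₁⁻¹ - 1) :=
    periodicGroundStateEnergy_eq_ofReal d
  have h1 : 1 ≤ d.κ₁⁻¹ := twoModeData_one_le_inv_κ₁ d
  have hgap : d.κ₁⁻¹ < d.κ₂⁻¹ := by
    have hlt := PeriodicGroundStateNondegenerate_holds (n + 1) L v (Nat.succ_pos n) hL hmeas ⟨C, hC⟩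
    rw [hE₀, kyFanTwo_eq_ofReal d,
      show (2 : ℝ≥0∞) * ENNReal.ofReal (d.κ₁⁻¹ - 1) = ENNReal.ofReal (2 * (d.κ₁⁻¹ - 1)) by
        rw [ENNReal.ofReal_mul zero_le_two, ENNReal.ofReal_ofNat],
      ENNReal.ofReal_lt_ofReal_iff_of_nonneg (by linarith)] at hlt
    linarith
  have hg0 : 0 < d.κ₂⁻¹ - d.κ₁⁻¹ := sub_pos.2 hgap
  refine ⟨ENNReal.ofReal ((d.κ₂⁻¹ - d.κ₁⁻¹) * (η ^ 2 / 2)),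
    ENNReal.ofReal_pos.2 (by positivity), fun Ψ Φ hΨ hΦ => ?_⟩
  -- the vectors
  set FΨ : periodicCore (n + 1) L := ⟨Ψ.ψ, Ψ.mem_periodicCore⟩ with hFΨ
  set FΦ : periodicCore (n + 1) L := ⟨Φ.ψ, Φ.mem_periodicCore⟩ with hFΦ
  have huΨ : ‖ι (J FΨ)‖ = 1 := norm_formEmbed_graphEmbed_trialState hL hmeas hW Ψ
  have huΦ : ‖ι (J FΦ)‖ = 1 := norm_formEmbed_graphEmbed_trialState hL hmeas hW Φ
  have hnormJ : ∀ F : periodicCore (n + 1) L, ‖J F‖ = ‖graphEmbed hL hmeas hW F‖ := fun F => by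
    rw [hJapply]; rfl
  have hQΨ : ‖J FΨ‖ ^ 2 = 1 + (periodicEnergy v Ψ).toReal := by
    rw [hnormJ]; exact norm_graphEmbed_sq_trialState hL hmeas hW Ψ
  have hQΦ : ‖J FΦ‖ ^ 2 = 1 + (periodicEnergy v Φ).toReal := by
    rw [hnormJ]; exact norm_graphEmbed_sq_trialState hL hmeas hW Φ
  -- energies as real numbers
  have hEΨ : (periodicEnergy v Ψ).toReal = d.κ₁⁻¹ - 1 := by
    rw [hΨ, hE₀, ENNReal.toReal_ofReal (by linarith)]
  have hEΦ : (periodicEnergy v Φ).toReal ≤ d.κ₁⁻¹ - 1 + (d.κ₂⁻¹ - d.κ₁⁻¹) * (η ^ 2 / 2) := by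
    rw [hE₀, ← ENNReal.ofReal_add (by linarith) (by positivity)] at hΦ
    have := ENNReal.toReal_mono ENNReal.ofReal_ne_top hΦ
    rwa [ENNReal.toReal_ofReal (by nlinarith [sq_nonneg η])] at this
  -- the abstract stability argument: `‖ιΨ - c•ιΦ‖² ≤ η²`
  obtain ⟨c, hc, hdist⟩ := twoModeData_exists_phase_norm_sub_sq_le (ι := ι) d hgap
    (u := J FΨ) (w := J FΦ) huΨ huΦ (t := η ^ 2) (by linarith) (by linarith)
  refine ⟨c, hc, ?_⟩
  -- back to functions on the cell: `∫_cell |Ψ - cΦ|² ≤ η²`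
  have hcore : ι (J FΨ) - c • ι (J FΦ) = ι (J (FΨ - c • FΦ)) := by
    simp only [map_sub, map_smul]
  have hfun : ((FΨ - c • FΦ : periodicCore (n + 1) L) : Config (n + 1) → ℂ) =
      fun X => Ψ.ψ X - c * Φ.ψ X := by
    ext X
    simp [hFΨ, hFΦ]
  have hcontd : Continuous fun X => Ψ.ψ X - c * Φ.ψ X :=
    Ψ.contDiff.continuous.sub (continuous_const.mul Φ.contDiff.continuous)
  have hnorm : ‖ι (J (FΨ - c • FΦ))‖ ^ 2 =
      (∫⁻ X in cellN (n + 1) L,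
        (‖((FΨ - c • FΦ : periodicCore (n + 1) L) : Config (n + 1) → ℂ) X‖₊ : ℝ≥0∞) ^ 2).toReal :=
    norm_formEmbed_graphEmbed_sq hL hmeas hW (FΨ - c • FΦ)
  simp only [hfun, ← hcore] at hnorm
  have hfin' : (∫⁻ X in cellN (n + 1) L, (‖Ψ.ψ X - c * Φ.ψ X‖₊ : ℝ≥0∞) ^ 2) ≠ ⊤ :=
    (lintegral_cellN_sq_lt_top L hcontd).ne
  rw [← ENNReal.ofReal_toReal hfin', ← hnorm]
  exact ENNReal.ofReal_le_ofReal hdist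

/-! ### Positivity of the coherence of near-minimisers (bounded admissible class) -/

/-- **Near-minimisers of the periodic `N`-body energy have strictly positive translation coherence,
for every bounded admissible pair potential, at fixed `N` and `L > 0`.** For `v` repulsive,
finite-range, measurable with `v ≤ M < ∞` there is `δ = δ(v, N, L) > 0` such that every periodic `C¹`
Bose trial state `Φ` with `periodicEnergy v Φ ≤ E₀^per(N, L) + δ` has
`G_Φ(i,r) = Re ∫_{cell^N} conj Φ(…, xᵢ + r, …) Φ(X) dX > 0` for every particle `i` and every
`r ∈ ℝ³`. Proof: a pointwise positive `C¹` minimiser `Ψ₀` exists (`boundedPositiveMinimiser_holds`: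
Perron–Frobenius via Feynman–Kac plus `C¹`-regularity); its coherence is bounded below by some
`g > 0` uniformly in `(i, r)` (`exists_pos_le_coh`); near-minimisers are `L²(cell)`-close to `Ψ₀` up
to a phase (`exists_phase_near_of_nearMinimiser`, spectral gap); and the coherence is `2`-Lipschitz
in `L²(cell)` and phase-blind (`abs_coh_sub_coh_le`). This is, on the bounded class, the positivity
hypothesis `CoherencePos` of `periodicBEC_of_levyNegativeMoment_of_coherencePos`
(`…LevyNegativeMomentTargetStrength.lean`) and the first conjunct of the sister crux
`GridInfDivCoherence` at fixed `(N, L)`. [cite: ReedSimonIV1978, §XIII.12 Thms XIII.43–XIII.47] -/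
theorem coherencePos_of_bounded {v : ℝ → ℝ≥0∞} (hv : IsRepulsiveFiniteRange v) {M : ℝ≥0}
    (hM : ∀ r, v r ≤ M) (N : ℕ) {L : ℝ} (hL : 0 < L) :
    ∃ δ : ℝ≥0∞, 0 < δ ∧ ∀ Φ : PeriodicTrialState N L,
      periodicEnergy v Φ ≤ periodicGroundStateEnergy v N L + δ →
        ∀ (i : Fin N) (r : Space),
          0 < (∫ X in cellN N L, conj (Φ.ψ (Function.update X i (X i + r))) * Φ.ψ X).re := by
  rcases N with _ | n
  · exact ⟨1, one_pos, fun Φ _ i => Fin.elim0 i⟩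
  obtain ⟨Ψ₀, hE, -, hreal, hne⟩ := boundedPositiveMinimiser_holds hv
    ⟨M, ENNReal.coe_ne_top, fun r => hM r⟩ n hL
  obtain ⟨g, hg, hle⟩ := exists_pos_le_coh hL Ψ₀ hreal hne
  obtain ⟨δ, hδ, H⟩ := exists_phase_near_of_nearMinimiser hv hM n hL (η := g / 4) (by positivity)
  refine ⟨δ, hδ, fun Φ hΦ i r => ?_⟩
  obtain ⟨c, hc, hclose⟩ := H Ψ₀ Φ hE hΦ
  have hlip := abs_coh_sub_coh_le hL Ψ₀ Φ hc i r (by positivity : (0 : ℝ) ≤ g / 4) hclose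
  have hfloor := hle i r
  have h1 := (abs_sub_le_iff.1 hlip).1
  linarith

end CoherencePos

end Summit.AtomisticToContinuum.BoseEinsteinCondensation.Theorems

end
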